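import Literature.MathematicalPhysics.QuantumLattice.DWaveSourceThermalStatesDKMS
import Literature.MathematicalPhysics.QuantumLattice.FermionDKMSStatesGaugeOrbit
import Literature.MathematicalPhysics.QuantumLattice.DWaveKomaTasakiThermalTTPrime
import Literature.MathematicalPhysics.QuantumLattice.KomaTasakiGriffithsTheoremSubsequence
import Literature.MathematicalPhysics.QuantumLattice.TranslationInvariantStatePairLRO
import Literature.MathematicalPhysics.QuantumLattice.DWaveSourceThermalStatesBogoliubovRows
import Literature.MathematicalPhysics.QuantumLattice.FermionBogoliubovRowsMerminWagner
import HarnessLib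

/-!
# Koma–Tasaki's infinitesimal pair-field thermal states of the 2D `t–t'` Hubbard model: equilibrium (dKMS) states of the
# model; thermal `d`-wave pair long-range order WOULD force `Re ω(P^d_x) ≥ σ/√2` in every one of them (`U(1)` breaking at `T > 0`)
# — and they are all gauge invariant (Mermin–Wagner), so the 2D model has NO thermal `d`-wave pair long-range order, any `t'`

Topic `Literature/MathematicalPhysics/QuantumLattice` (namespace = path; family `hubbard`).  Sequel of `DWaveSourceThermalStatesDKMS`
(rows ⇒ sourced thermal torus limits are dKMS states of the sourced interaction; zero-source limits are dKMS states of
`gcInteractionTT' t t' U μ 0`), of `DWaveKomaTasakiThermalTTPrime` (the pair-sourced `t–t'` torus IS a Koma–Tasaki `ℤ₂` system,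
`dWaveZ2SystemTT'`), of `KomaTasakiGriffithsTheoremSubsequence` (KT93 Thm 2.1 / Cor 2.2-`U(1)` WITHOUT hypothesis i)), and of
`FermionDKMSStatesGaugeOrbit` (gauge orbits of equilibrium states; PBC Gibbs limits are gauge symmetric).  It types, for the
PAIR-SOURCED tori of the cuprate cell `A_L(h) = dWaveSourceTorusTT' L t' U μ h = H_L(1,t',U) − μN − h(Δ_d + Δ_d†)`, Koma–Tasaki's
construction of symmetry-breaking EQUILIBRIUM states at `T > 0` (CMP 158 (1993) §1 p. 193 (1.8)–(1.10): «apply an infinitesimally small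
symmetry breaking field», `ω̃ = lim_{B↓0} lim_{Λ↑∞} ⟨·⟩_{β, H_Λ − BO_Λ}`, `m_s ≥ √3σ` (there `SU(2)`); §7 p. 211: the method «allows one to
apply the theorem to … the electron pair condensation problems in lattice electron systems»; J. Stat. Phys. 76 (1994) §3.4: the
electron data `o_x`, `U(1)` generated by `(N_e − N)/2`) — and the IMPLICATION it carries for the Hubbard model BY NAME.

## Contents (two definitions with bodies — the state classes; everything else PROVED; no named fact; zero compute)

* §1 `DWaveKT.IsSourcedThermalState β t' U μ h ω` (a torus limit, along some `Ls → ∞`, of the grand-canonical Gibbs states of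
  `A_L(h)`: the tree's format `IsTorusLimitOfMixture sourcedGibbsCount (sourcedGibbsWeightTT' β …) (sourcedGibbsVectorTT' …) Ls`)
  and `DWaveKT.IsInfinitesimalFieldThermalState β t' U μ ω` (a weak-⋆ limit of sourced thermal states at `h_k > 0`, `h_k → 0`):
  translation invariance; **dKMS at `β` of the SOURCED interaction** (`IsSourcedThermalState.isDKMSState`) resp. **of the
  grand-canonical `t–t'` Hubbard interaction `gcInteractionTT' 1 t' U μ 0`** (`IsInfinitesimalFieldThermalState.isDKMSState` — KT's
  states (1.8) are genuine equilibrium states of the unperturbed model); EXISTENCE for all real `β, t', U, μ` (`h`) by weak-⋆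
  compactness (`exists_isSourcedThermalState[_subseq]`, `exists_isInfinitesimalFieldThermalState[_of_tendsto]`); at `h = 0` the class
  IS the PBC thermal grand-canonical class at `t = 1` (`isSourcedThermalState_zero_iff`): gauge invariant, `ω(P_x) = 0`, dKMS.
* §2 KT93 THEOREM 2.1 / COROLLARY 2.2-`U(1)` (`√2`) WITHOUT HYPOTHESIS i) along any `Ls → ∞`, in eigen-mixture form
  (`eventually_sqrt_two_mul_le_sourcedGibbsMixture_pairField`; `log dim 𝓗_L ≤ log 4·|Λ_L|`; the `U(1)` data `O^{(2)} = i(Δ_d − Δ_d†)`,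
  `C = N̂`, `κ = 50` of `DWaveKomaTasakiThermal`).
* §3 **THE IMPLICATIONS** (`β > 0`; HYPOTHESIS `hLRO`: the ZERO-source Gibbs states have thermal `d`-wave pair long-range order,
  `σ² ≤ (L²)⁻² Re⟨(Δ_d+Δ_d†)²⟩_{β, A_L(0)}` eventually in `L`):
  (a) `IsTorusLimitOfMixture.sqrt_two_mul_le_two_mul_re_expect_localPairAt_of_sourcedGibbs` /
  `IsSourcedThermalState.sqrt_two_mul_le_two_mul_re_expect_localPairAt`: every sourced thermal state at `(β, B)`, `B > 0`, has
  `√2σ ≤ 2 Re ω(P^d_x)` at EVERY site (`m_Λ(B) → Re ω(P^d_x + P^d_x†)` along the torus limit; KT's `liminf_Λ m_Λ(B) ≥ √2σ`);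
  (b) `IsInfinitesimalFieldThermalState.sqrt_two_mul_le_two_mul_re_expect_localPairAt`: so does every infinitesimal pair-field
  thermal state — KT93 (1.10) for electrons, `m_s ≥ √2σ`, in infinite volume;
  (c) **`IsInfinitesimalFieldThermalState.U1Breaking_of_thermal_pairLRO`** (`σ > 0`): such an `ω` is a translation-invariant dKMS
  state of `gcInteractionTT' 1 t' U μ 0` at `β` with `Re ω(P^d_x) ≥ σ/√2 > 0` at every site, hence NOT gauge invariant, NOT a
  thermodynamic limit of periodic-b.c. grand-canonical Gibbs states at any temperature, and `{ω ∘ γ_θ : θ ∈ [0,π)}` is an injective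
  family of dKMS states at `β` with pair amplitudes `e^{−2iθ}ω(P^d_x)`; the dKMS set at `β` is not a singleton;
  (d) **`hubbardTTPrime_thermal_pairLRO_U1Breaking`** (existence form): at the same `β` the zero-source thermal state `ω₀` is a
  gauge-INVARIANT dKMS state with `ω₀(P^d_x) = 0` AND an infinitesimal pair-field thermal state with (c) exists — the symmetric
  state coexists with a continuum of symmetry-breaking equilibrium states: THE `U(1)` SYMMETRY IS BROKEN AT INVERSE TEMPERATURE `β`.
  (`InfVolFermionState.…_of_tendsto_sourcedGibbs` forms with the defining data explicit are given alongside.)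
* §4 ZERO TEMPERATURE: `β_k → ∞` (and `h_k → h`, resp. `h_k → 0`) limits of sourced thermal states / of infinitesimal pair-field
  thermal states are infinite-volume GROUND states of the sourced interaction / of `gcInteractionTT' 1 t' U μ 0`
  (`isGroundState[_gcInteractionTT']_of_sourcedThermalStates_tendsto_atTop`, `isGroundState_of_infinitesimalFieldThermalStates_tendsto_atTop`;
  Bratteli–Kishimoto–Robinson along the source pencil, `DWaveSourceThermalStatesDKMS` §5), and such limits exist
  (`exists_isGroundState_of_infinitesimalFieldThermalStates`) — Koma–Tasaki's ground states «`β ↑ ∞` after `Λ ↑ ∞`».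
* §5 **MERMIN–WAGNER FOR KOMA–TASAKI'S THERMAL STATES; NO THERMAL `d`-WAVE PAIR LRO IN TWO DIMENSIONS, EVERY `t'`.** Sourced thermal
  states have the Bogoliubov rows of the SOURCED interaction (`IsSourcedThermalState.hasBogoliubovRows`, from
  `DWaveSourceThermalStatesBogoliubovRows`); the rows are affine in `h`, so infinitesimal pair-field thermal states have the Bogoliubov
  rows of `gcInteractionTT' 1 t' U μ 0` (`IsInfinitesimalFieldThermalState.hasBogoliubovRows`); by the Klein–Landau–Shucker theorem for
  states with Bogoliubov rows (`FermionBogoliubovRowsMerminWagner`) every infinitesimal pair-field thermal state at `β ≥ 0` annihilates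
  every local observable of nonzero particle number, has `ω(P_x) = 0` for every local singlet pair and IS GAUGE INVARIANT
  (`….expect_eq_zero_of_numberCharged`, `….expect_localPairAt_eq_zero`, `….isGaugeInvariant`). With §3(b) this REFUTES the hypothesis
  `hLRO` for every `σ > 0`, every `β > 0` and every `t', U, μ` (**`not_thermal_dWavePairLRO`**): the zero-source periodic-b.c. Gibbs
  states of the 2D `t–t'` Hubbard model have NO thermal `d`-wave pair long-range order, `liminf_L (L²)⁻² Re⟨(Δ_d+Δ_d†)²⟩_{β,L} = 0`
  (`frequently_thermal_dWavePairCorrelation_lt`). The implications of §3(c),(d) are thus vacuously true for the strictly 2D model —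
  their content is the certificate SHAPE, KT93's `m_s ≥ √2σ` transferred to lattice electrons.

HONEST SCOPE / WHAT THIS IS NOT: IMPLICATIONS ONLY — no pair long-range order, no superconductivity, is asserted for the Hubbard
model at any `(t', U, μ, β)`; the LRO is the hypothesis `hLRO`, and §5 PROVES it false for the strictly two-dimensional model at
every `β > 0` and every `t'` (Mermin–Wagner for the infinitesimal-field states) — the content of §2–§3 is the certificate SHAPE «certified
finite-volume thermal LRO ⇒ order-parameter floor and phase coexistence in infinite volume», KT93's `m_s ≥ √2σ`, for the fermionic /
Hubbard case, to be used where Mermin–Wagner does not bite (three dimensions, stacked layers) once the corresponding Koma–Tasaki system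
is typed; dKMS ⟺ KMS (Araki–Moriya Thm. 6.4) is cited, not formalised; purity / extremality of `ω̃` (KT93 p. 193: «likely … but there
is no proof») is not touched; no number of record (the `liminf = 0` of §5 is qualitative; the tree's McBryan–Spencer files
`HubbardBondPairDecaySharpTTPrime` carry the quantitative power-law decay).  The finite-volume Gibbs expectations of §2–§3 and §5 (`gibbsState β (dWaveSourceTorusTT' …) …`)
are stated in the `DecidableEq (FermionTorus 2 L)` environment of the Koma–Tasaki dictionary files
(`attribute [local instance 10000] instDecidableEqFermionTorusKT`, as in `DWaveKomaTasakiThermalTTPrime`,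
`HubbardDWaveGroundStateFiniteVolumeFieldBound`): a consumer's certified thermal LRO row must be stated in the same environment.

## Mathlib / tree search

`lean search 'IsSourcedThermalState|IsInfinitesimalFieldThermalState|U1Breaking'` (2026-08-29): only the spin / π-flux classes
`XXZKT.IsInfinitesimalField{Thermal,Ground}State` (`XXZAntiferromagnetInfiniteVolumeOrder`), `KomaPiFlux.IsSourcedThermalLimit` /
`….IsInfinitesimalFieldThermalState` (`KomaPiFluxThermalInfiniteVolumeOrder`) — the templates followed here; nothing for the Hubbard
model. REUSED: `IsTorusLimitOfMixture.isDKMSState_of_sourcedGibbs`, `IsDKMSState.gcInteractionTT'_of_tendsto_source`,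
`sum_sourcedGibbsWeightTT'_mul_expect_eq_gibbsState`, `sum_sourcedGibbsWeightTT'_mul_torusAvgExpect_localPairAt_zero`
(`DWaveSourceThermalStatesDKMS`); `isTorusLimitOfMixture_sourcedGibbs_zero_field_iff` (`HubbardTTPrimeGrandCanonicalThermalStatesExistence`);
`IsTorusLimitOfMixture.{isGaugeInvariant_of_gcGibbs, expect_localPairAt_eq_zero_of_gcGibbs, isDKMSState_of_gcGibbs}`,
`IsDKMSState.gaugeOrbit_gcTT'`, `….not_subsingleton_fermionDKMSStates_of_expect_localPairAt_ne_zero`,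
`not_isTorusLimitOfMixture_gcGibbs_of_expect_localPairAt_ne_zero` (`FermionDKMSStates{,GaugeOrbit}`); `IsGaugeInvariant.expect_eq_zero_of_hasGaugeCharge`,
`hasGaugeCharge_localPairAt`, `gaugeShift_expect_localPairAt` (`InfVolFermionStateGaugeAction`);
`dWaveZ2SystemTT'{,_hamiltonian,_order,_magnetisation_dWave,_moment_dWave}` (`DWaveKomaTasakiThermalTTPrime`), `isHermitian_I_smul_pairField_sub`,
`norm_I_smul_pairField_sub_le`, `totalNumber_comm_I_smul_pairField_sub`, `totalNumber_comm_pairField_add`, `norm_comm_orderTwo_orderOne_le`,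
`DWaveKT.pairNormConst_dWave_pos` (`DWaveKomaTasakiThermal/System`), `hubbardTorusTT'_commute_totalNumber`;
`KomaTasaki.Z2System.le_sqrt_two_mul_magnetisation_add_of_eventually_moment_one_u1` (`KomaTasakiGriffithsTheoremSubsequence`);
`gibbsState_congr_inst`, `gibbsState_conjTranspose`, `log_sourcedGibbsCount_le`; `IsTorusLimitOfMixture.{isTranslationInvariant,comp_tendsto}`,
`InfVolFermionState.exists_isTorusLimitOfMixture_subseq`, `exists_tendsto_expect_subseq`, `isTranslationInvariant_of_tendsto_expect`;
`IsTranslationInvariant.expect_localPairAt_eq` (`TranslationInvariantStatePairLRO`); §5: `IsTorusLimitOfMixture.bogoliubovRow_nonneg_of_sourcedGibbs`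
(`DWaveSourceThermalStatesBogoliubovRows`), `HasBogoliubovRows.{of_tendsto_pencil, expect_eq_zero_of_numberCharged_ttPrime, expect_localPairAt_eq_zero_ttPrime,
isGaugeInvariant_ttPrime}` (`FermionBogoliubovRowsMerminWagner`), `hubbardTTPrimeSourcedInteraction_zero_eq_gcInteractionTT'`.

## References

* [KomaTasaki1993] T. Koma, H. Tasaki, *Symmetry breaking in Heisenberg antiferromagnets*, Commun. Math. Phys. 158 (1993)
  191–214: §1 p. 193 (1.5)–(1.10); §2 (2.11), Theorem 2.1 (2.13), Corollary 2.2 (2.18), Remark after Theorem 6.1 (`U(1)`: `√2`);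
  §7 p. 211.
* [KomaTasaki1994] T. Koma, H. Tasaki, *Symmetry breaking and finite-size effects in quantum many-body systems*, J. Stat. Phys.
  76 (1994) 745–803: §1, §3.4, Cor. 2.9.
* [ArakiMoriya2003] H. Araki, H. Moriya, Rev. Math. Phys. 15 (2003) 93–198: Def. 6.3, Thm. 6.4.
* [BratteliRobinsonII1997] O. Bratteli, D. W. Robinson, *Operator Algebras and Quantum Statistical Mechanics 2*, 2nd ed. (1997):
  Prop. 5.3.25, Thm. 5.3.30, Prop. 5.3.33, §5.3.1.
* [BratteliRobinsonI1987] O. Bratteli, D. W. Robinson, *Operator Algebras and Quantum Statistical Mechanics 1*, 2nd ed. (1987),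
  §4.3.1, Thm. 2.3.15.
* [FawziFawziScalet2024] H. Fawzi, O. Fawzi, S. O. Scalet, Nat. Commun. 15 (2024) 7394 = arXiv:2311.18706, Thm. 3.1.
* [Israel1979] R. B. Israel, *Convexity in the Theory of Lattice Gases* (1979), Lemma II.3.1.
* [KleinLandauShucker1981] A. Klein, L. J. Landau, D. S. Shucker, J. Stat. Phys. 26 (1981) 505–512 (no continuous symmetry breaking in
  any KMS state in two dimensions).
* [DLS1978] F. J. Dyson, E. H. Lieb, B. Simon, J. Stat. Phys. 18 (1978) 335, §2 eq. (28) (Bogoliubov's inequality).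
* [KomaTasakiPRL1992] T. Koma, H. Tasaki, Phys. Rev. Lett. 68 (1992) 3248 (no superconducting LRO in 1D/2D Hubbard models at `T > 0`).
-/

noncomputable section

namespace Literature.MathematicalPhysics.QuantumLattice

open Matrix Finset HubbardWave0 Literature.Probability.LatticeModels ThermodynamicLimit
open _root_.Filter
open scoped _root_.Topology ComplexOrder BigOperators Matrix.Norms.L2Operator

/-! ### §1 The sourced thermal states at `(β, h)` and the infinitesimal pair-field thermal states at `β` -/

namespace DWaveKT

/-- **A sourced thermal state of the `t–t'` Hubbard model at `(β; t', U, μ; h)`** (Koma–Tasaki's `lim_{Λ↑∞} ⟨·⟩_{β, H_Λ − hO_Λ}`,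
the inner limit of (1.8)/(2.11)): an infinite-volume state of the lattice-fermion algebra on `ℤ²` which is a torus limit — along
some divergent side sequence `Ls` — of the translation averages of the grand-canonical Gibbs states `e^{−βA_L}/tr e^{−βA_L}` of the
pair-sourced tori `A_L = dWaveSourceTorusTT' L t' U μ h = H_L(1,t',U) − μN − h(Δ_d + Δ_d†)` (the eigen-mixtures
`sourcedGibbs{Count,WeightTT',VectorTT'}` of `DWaveSourceThermalGibbsMixtureDefs`). [cite: KomaTasaki1993, §1 (1.8) and §2 (2.11)]
[cite: KomaTasaki1994, §1, §3.4] [cite: BratteliRobinsonI1987, §4.3.1] -/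
def IsSourcedThermalState (β tp U μ h : ℝ) (ω : InfVolFermionState 2) : Prop :=
  ∃ Ls : ℕ → ℕ, Tendsto Ls atTop atTop ∧
    ω.IsTorusLimitOfMixture sourcedGibbsCount (sourcedGibbsWeightTT' β tp U μ h) (sourcedGibbsVectorTT' tp U μ h) Ls

/-- **An infinitesimal pair-field thermal state of the `t–t'` Hubbard model at `β`** (Koma–Tasaki 1993 (1.8): «apply an
infinitesimally small symmetry breaking field», `lim_{h↓0} lim_{Λ↑∞} ⟨·⟩_{β, H_Λ − hO_Λ}`): a weak-⋆ limit — pointwise on every local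
algebra `𝔄_Λ` — of sourced thermal states `ω_k` at `(β, h_k)` with `h_k > 0`, `h_k → 0`. [cite: KomaTasaki1993, §1 (1.8)]
[cite: KomaTasaki1994, §3.4] -/
def IsInfinitesimalFieldThermalState (β tp U μ : ℝ) (ω : InfVolFermionState 2) : Prop :=
  ∃ (hk : ℕ → ℝ) (ωk : ℕ → InfVolFermionState 2), (∀ k, 0 < hk k) ∧ Tendsto hk atTop (𝓝 0) ∧
    (∀ k, IsSourcedThermalState β tp U μ (hk k) (ωk k)) ∧
    ∀ (Λ : Finset (Site 2)) (A : FermionOp Λ), Tendsto (fun k => (ωk k).expect Λ A) atTop (𝓝 (ω.expect Λ A))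

variable {β tp U μ h : ℝ} {ω : InfVolFermionState 2}

/-- Unfolding lemma. [cite: KomaTasaki1993, §1 (1.8)] -/
theorem isSourcedThermalState_iff : IsSourcedThermalState β tp U μ h ω ↔ ∃ Ls : ℕ → ℕ, Tendsto Ls atTop atTop ∧
    ω.IsTorusLimitOfMixture sourcedGibbsCount (sourcedGibbsWeightTT' β tp U μ h) (sourcedGibbsVectorTT' tp U μ h) Ls :=
  Iff.rfl

/-- Constructor from the tree's torus-limit format. [cite: BratteliRobinsonI1987, §4.3.1] -/
theorem IsSourcedThermalState.of_isTorusLimitOfMixture {Ls : ℕ → ℕ}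
    (hω : ω.IsTorusLimitOfMixture sourcedGibbsCount (sourcedGibbsWeightTT' β tp U μ h) (sourcedGibbsVectorTT' tp U μ h) Ls)
    (hLs : Tendsto Ls atTop atTop) : IsSourcedThermalState β tp U μ h ω :=
  ⟨Ls, hLs, hω⟩

/-- Sourced thermal states are translation invariant. [cite: BratteliRobinsonI1987, §4.3.1] -/
theorem IsSourcedThermalState.isTranslationInvariant (hω : IsSourcedThermalState β tp U μ h ω) : ω.IsTranslationInvariant := by
  obtain ⟨Ls, -, h⟩ := hω
  exact h.isTranslationInvariant

/-- **Sourced thermal states are equilibrium (dKMS) states at `β` of the SOURCED interaction** `Φ(1,t',U) − μn − hP_d`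
(`DWaveSourceThermalStatesDKMS`). [cite: ArakiMoriya2003, Def 6.3] [cite: FawziFawziScalet2024, Thm. 3.1] -/
theorem IsSourcedThermalState.isDKMSState (hω : IsSourcedThermalState β tp U μ h ω) :
    ω.IsDKMSState (hubbardTTPrimeSourcedInteraction 1 tp U μ dWaveFormFactor h) 1 β := by
  obtain ⟨Ls, hLs, h⟩ := hω
  exact h.isDKMSState_of_sourcedGibbs tp U μ _ hLs

/-- **Sourced thermal states EXIST along a subsequence of every divergent side sequence** (weak-⋆ compactness: the weights are a
probability vector, the components unit vectors), for all real `β, t', U, μ, h`. [cite: BratteliRobinsonI1987, Thm. 2.3.15 and §4.3.1] -/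
theorem exists_isSourcedThermalState_subseq (β tp U μ h : ℝ) {Ls : ℕ → ℕ} (hLs : Tendsto Ls atTop atTop)
    (hL0 : ∀ j, Ls j ≠ 0) :
    ∃ φ : ℕ → ℕ, StrictMono φ ∧ ∃ ω : InfVolFermionState 2,
      ω.IsTorusLimitOfMixture sourcedGibbsCount (sourcedGibbsWeightTT' β tp U μ h) (sourcedGibbsVectorTT' tp U μ h) (Ls ∘ φ) ∧
        IsSourcedThermalState β tp U μ h ω := by
  obtain ⟨φ, hφ, ω, hω⟩ := InfVolFermionState.exists_isTorusLimitOfMixture_subseq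
    (sourcedGibbsWeightTT' β tp U μ h) (sourcedGibbsVectorTT' tp U μ h) hLs
    (fun _ i => sourcedGibbsWeightTT'_nonneg tp U μ h β _ i) (fun _ => sum_sourcedGibbsWeightTT' tp U μ h β _)
    (fun j i => by haveI : NeZero (Ls j) := ⟨hL0 j⟩; exact star_sourcedGibbsVectorTT'_dotProduct_self tp U μ h _ i)
  exact ⟨φ, hφ, ω, hω, ⟨Ls ∘ φ, hLs.comp hφ.tendsto_atTop, hω⟩⟩

/-- **Sourced thermal states exist** for all real `β, t', U, μ, h`. [cite: BratteliRobinsonI1987, Thm. 2.3.15 and §4.3.1] -/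
theorem exists_isSourcedThermalState (β tp U μ h : ℝ) : ∃ ω : InfVolFermionState 2, IsSourcedThermalState β tp U μ h ω := by
  obtain ⟨φ, -, ω, -, hω⟩ := exists_isSourcedThermalState_subseq β tp U μ h (Ls := fun j => j + 1) (tendsto_add_atTop_nat 1)
    fun j => Nat.succ_ne_zero j
  exact ⟨ω, hω⟩

/-- **At zero source the sourced thermal states are exactly the PBC thermal grand-canonical states at `t = 1`, `h_z = 0`**
(`isTorusLimitOfMixture_sourcedGibbs_zero_field_iff`): so they are gauge invariant, have zero pair amplitude on every local singlet
pair, and are dKMS states of `gcInteractionTT' 1 t' U μ 0` (`FermionDKMSStates{,GaugeOrbit}`). [cite: KomaTasaki1994, §1]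
[cite: BratteliRobinsonII1997, §5.3.1] -/
theorem isSourcedThermalState_zero_iff : IsSourcedThermalState β tp U μ 0 ω ↔ ∃ Ls : ℕ → ℕ, Tendsto Ls atTop atTop ∧
    ω.IsTorusLimitOfMixture sourcedGibbsCount (gcGibbsWeightTT' β 1 tp U μ 0) (gcGibbsVectorTT' 1 tp U μ 0) Ls := by
  constructor
  · rintro ⟨Ls, hLs, h⟩
    exact ⟨Ls, hLs, (isTorusLimitOfMixture_sourcedGibbs_zero_field_iff tp U μ β hLs).1 h⟩
  · rintro ⟨Ls, hLs, h⟩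
    exact ⟨Ls, hLs, (isTorusLimitOfMixture_sourcedGibbs_zero_field_iff tp U μ β hLs).2 h⟩

/-- The zero-source thermal states are gauge invariant … [cite: BratteliRobinsonII1997, §5.3.1] -/
theorem IsSourcedThermalState.isGaugeInvariant_of_zero (hω : IsSourcedThermalState β tp U μ 0 ω) : ω.IsGaugeInvariant := by
  obtain ⟨Ls, hLs, h⟩ := isSourcedThermalState_zero_iff.1 hω
  exact h.isGaugeInvariant_of_gcGibbs β 1 tp U μ 0 hLs

/-- … have zero pair amplitude on every local singlet pair … [cite: KomaTasaki1994, §1] -/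
theorem IsSourcedThermalState.expect_localPairAt_eq_zero_of_zero (hω : IsSourcedThermalState β tp U μ 0 ω)
    (S : Finset (Site 2)) (g : Site 2 → ℝ) (x : Site 2) : ω.expect (pairRegion S x) (localPairAt S g x) = 0 := by
  obtain ⟨Ls, hLs, h⟩ := isSourcedThermalState_zero_iff.1 hω
  exact h.expect_localPairAt_eq_zero_of_gcGibbs β 1 tp U μ 0 hLs S g x

/-- … and are dKMS states at `β` of the grand-canonical `t–t'` Hubbard interaction. [cite: ArakiMoriya2003, Def 6.3] -/
theorem IsSourcedThermalState.isDKMSState_gcInteractionTT'_of_zero (hω : IsSourcedThermalState β tp U μ 0 ω) :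
    ω.IsDKMSState (gcInteractionTT' 1 tp U μ 0) 1 β := by
  obtain ⟨Ls, hLs, h⟩ := isSourcedThermalState_zero_iff.1 hω
  exact h.isDKMSState_of_gcGibbs 1 tp U μ 0 hLs

/-- Unfolding lemma. [cite: KomaTasaki1993, §1 (1.8)] -/
theorem isInfinitesimalFieldThermalState_iff : IsInfinitesimalFieldThermalState β tp U μ ω ↔
    ∃ (hk : ℕ → ℝ) (ωk : ℕ → InfVolFermionState 2), (∀ k, 0 < hk k) ∧ Tendsto hk atTop (𝓝 0) ∧
      (∀ k, IsSourcedThermalState β tp U μ (hk k) (ωk k)) ∧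
      ∀ (Λ : Finset (Site 2)) (A : FermionOp Λ), Tendsto (fun k => (ωk k).expect Λ A) atTop (𝓝 (ω.expect Λ A)) :=
  Iff.rfl

/-- Infinitesimal pair-field thermal states are translation invariant. [cite: BratteliRobinsonI1987, §4.3.1] -/
theorem IsInfinitesimalFieldThermalState.isTranslationInvariant (hω : IsInfinitesimalFieldThermalState β tp U μ ω) :
    ω.IsTranslationInvariant := by
  obtain ⟨hk, ωk, -, -, hωk, hlim⟩ := hω
  exact InfVolFermionState.isTranslationInvariant_of_tendsto_expect hlim fun k => (hωk k).isTranslationInvariant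

/-- **INFINITESIMAL PAIR-FIELD THERMAL STATES ARE EQUILIBRIUM (dKMS) STATES OF THE `t–t'` HUBBARD MODEL AT `β`** (every real
`β, t', U, μ`): zero-source limits of dKMS states of the sourced interactions are dKMS states of the grand-canonical interaction
`gcInteractionTT' 1 t' U μ 0` (`IsDKMSState.gcInteractionTT'_of_tendsto_source`). So Koma–Tasaki's states (1.8) at `T > 0` are
equilibrium states of the UNPERTURBED model in the sense of Araki–Moriya (⟺ KMS, Thm. 6.4, cited).
[cite: KomaTasaki1993, §1 (1.8)] [cite: ArakiMoriya2003, Def 6.3, Thm. 6.4] [cite: BratteliRobinsonII1997, Prop. 5.3.25] -/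
theorem IsInfinitesimalFieldThermalState.isDKMSState (hω : IsInfinitesimalFieldThermalState β tp U μ ω) :
    ω.IsDKMSState (gcInteractionTT' 1 tp U μ 0) 1 β := by
  obtain ⟨hk, ωk, -, hh, hωk, hlim⟩ := hω
  exact InfVolFermionState.IsDKMSState.gcInteractionTT'_of_tendsto_source (fun k => (hωk k).isDKMSState) hh
    tendsto_const_nhds hlim

/-- **Infinitesimal pair-field thermal states EXIST along every positive null sequence of sources** (choose a sourced thermal
state at each `h_k`, then a weak-⋆ convergent subsequence: sequential Banach–Alaoglu for the CAR algebra), for all real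
`β, t', U, μ`. [cite: BratteliRobinsonI1987, Thm. 2.3.15] [cite: KomaTasaki1993, §1 (1.8)] -/
theorem exists_isInfinitesimalFieldThermalState_of_tendsto (β tp U μ : ℝ) {hk : ℕ → ℝ} (hpos : ∀ k, 0 < hk k)
    (hh : Tendsto hk atTop (𝓝 0)) :
    ∃ ω : InfVolFermionState 2, IsInfinitesimalFieldThermalState β tp U μ ω := by
  choose ωk hωk using fun k => exists_isSourcedThermalState β tp U μ (hk k)
  obtain ⟨φ, hφ, ω, hlim⟩ := InfVolFermionState.exists_tendsto_expect_subseq ωk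
  exact ⟨ω, fun k => hk (φ k), fun k => ωk (φ k), fun k => hpos (φ k), hh.comp hφ.tendsto_atTop, fun k => hωk (φ k), hlim⟩

/-- **Infinitesimal pair-field thermal states exist** (sources `h_k = 1/(k+1)`), for all real `β, t', U, μ`.
[cite: BratteliRobinsonI1987, Thm. 2.3.15] [cite: KomaTasaki1993, §1 (1.8)] -/
theorem exists_isInfinitesimalFieldThermalState (β tp U μ : ℝ) :
    ∃ ω : InfVolFermionState 2, IsInfinitesimalFieldThermalState β tp U μ ω :=
  exists_isInfinitesimalFieldThermalState_of_tendsto β tp U μ (hk := fun k => 1 / ((k : ℝ) + 1))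
    (fun k => by positivity) tendsto_one_div_add_atTop_nhds_zero_nat

/-- For every `β`, **the grand-canonical `t–t'` Hubbard interaction has a translation-invariant dKMS state at `β` obtained by
Koma–Tasaki's infinitesimal-field construction** (besides the PBC thermal states of `FermionDKMSStates`).
[cite: KomaTasaki1993, §1 (1.8)] [cite: ArakiMoriya2003, Def 6.3] -/
theorem exists_isInfinitesimalFieldThermalState_isDKMSState (β tp U μ : ℝ) :
    ∃ ω : InfVolFermionState 2, IsInfinitesimalFieldThermalState β tp U μ ω ∧
      ω.IsDKMSState (gcInteractionTT' 1 tp U μ 0) 1 β ∧ ω.IsTranslationInvariant := by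
  obtain ⟨ω, hω⟩ := exists_isInfinitesimalFieldThermalState β tp U μ
  exact ⟨ω, hω, hω.isDKMSState, hω.isTranslationInvariant⟩

end DWaveKT

/-! ### §2 Thermal pair long-range order forces the pair amplitude of every sourced thermal state (KT93 Thm 2.1, `U(1)`: `√2`) -/

section KTFloor

attribute [local instance 10000] instDecidableEqFermionTorusKT

/-- `|Λ_L| = L²` for the torus `(ℤ/Lℤ)²`. [folklore] -/
private theorem card_torusSite_two_dkms (L : ℕ) [NeZero L] : Fintype.card (TorusSite 2 L) = L ^ 2 := by
  simp [TorusSite, ZMod.card]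

/-- `log dim 𝓗_L ≤ log 4 · |Λ_L|` (the Fock space of `2L²` orbitals has dimension `4^{L²}`). [cite: Israel1979, Lemma II.3.1] -/
private theorem log_card_fock_le (L : ℕ) [NeZero L] :
    Real.log (Fintype.card (Finset (Orb (FermionTorus 2 L)))) ≤ Real.log 4 * Fintype.card (TorusSite 2 L) := by
  have hc : Fintype.card (Finset (Orb (FermionTorus 2 L))) = sourcedGibbsCount L := by
    rw [sourcedGibbsCount]
    exact (Fintype.card_congr (Equiv.subtypeUnivEquiv fun _ => trivial)).symm
  rw [hc, card_torusSite_two_dkms, Nat.cast_pow]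
  exact log_sourcedGibbsCount_le L

/-- **KT93 COROLLARY 2.2 (`U(1)`, factor `√2`) WITHOUT HYPOTHESIS i) FOR THE PAIR-SOURCED `t–t'` HUBBARD TORI, along any
divergent side sequence, in eigen-mixture form**: if eventually in `L` the zero-source Gibbs states have `d`-wave pair
long-range order `σ² ≤ (L²)⁻² Re⟨(Δ_d+Δ_d†)²⟩_{β, A_L(0)}` (`σ ≥ 0`, `β > 0`), then for every `B > 0`, `ε > 0` and `Ls → ∞`,
eventually in `j`: `√2 σ ≤ 2·(Ls_j²)⁻¹ Σ_i p_{Ls_j,i} Re⟨ψ_{Ls_j,i}, Δ_d ψ_{Ls_j,i}⟩ + ε`, the mixture being the Gibbs state of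
`A_{Ls_j}(B)` (`= (Ls_j²)⁻¹ Re⟨Δ_d + Δ_d†⟩_{β, A_{Ls_j}(B)}`, KT's `m_Λ(B)`). Engine:
`KomaTasaki.Z2System.le_sqrt_two_mul_magnetisation_add_of_eventually_moment_one_u1` on `dWaveZ2SystemTT'`.
[cite: KomaTasaki1993, Theorem 2.1 (2.13), Corollary 2.2 (2.18), Remark after Theorem 6.1] [cite: KomaTasaki1994, §3.4] -/
theorem eventually_sqrt_two_mul_le_sourcedGibbsMixture_pairField (tp U μ : ℝ) {β : ℝ} (hβ : 0 < β)
    {Ls : ℕ → ℕ} [hL0 : ∀ j, NeZero (Ls j)] (hLs : Tendsto Ls atTop atTop) {σ : ℝ} (hσ : 0 ≤ σ)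
    (hLRO : ∀ᶠ L : ℕ in atTop, ∀ [NeZero L], σ ^ 2 ≤ (((L : ℝ) ^ 2) ^ 2)⁻¹ *
      (gibbsState β (dWaveSourceTorusTT' L tp U μ 0)
        ((pairField dWaveFormFactor L + (pairField dWaveFormFactor L)ᴴ) ^ 2)).re)
    {B : ℝ} (hB : 0 < B) {ε : ℝ} (hε : 0 < ε) :
    ∀ᶠ j in atTop, Real.sqrt 2 * σ ≤
      2 * ((((Ls j : ℕ) : ℝ) ^ 2)⁻¹ * ∑ i, sourcedGibbsWeightTT' β tp U μ B (Ls j) i *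
        (expect (pairField dWaveFormFactor (Ls j)) (sourcedGibbsVectorTT' tp U μ B (Ls j) i)).re) + ε := by
  have h := KomaTasaki.Z2System.le_sqrt_two_mul_magnetisation_add_of_eventually_moment_one_u1
    (fun j => dWaveZ2SystemTT' (Ls j) tp U μ dWaveFormFactor)
    (fun j => Complex.I • (pairField dWaveFormFactor (Ls j) - (pairField dWaveFormFactor (Ls j))ᴴ))
    (fun j => totalNumber) (ε := -2 * Complex.I) (κ := 50)
    (mul_ne_zero (by norm_num) Complex.I_ne_zero) (by norm_num)
    (fun j => isHermitian_I_smul_pairField_sub (Ls j) dWaveFormFactor)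
    (fun j => by
      rw [dWaveZ2SystemTT'_hamiltonian]
      exact (hubbardTorusTT'_commute_totalNumber (Ls j) 1 tp U).sub_left
        ((Commute.refl totalNumber).smul_left (μ : ℂ)))
    (fun j => by rw [dWaveZ2SystemTT'_order]; exact totalNumber_comm_I_smul_pairField_sub (Ls j) dWaveFormFactor)
    (fun j => by rw [dWaveZ2SystemTT'_order]; exact totalNumber_comm_pairField_add (Ls j) dWaveFormFactor)
    (fun j => norm_I_smul_pairField_sub_le (Ls j) dWaveFormFactor)
    (fun j => by
      rw [dWaveZ2SystemTT'_order]
      exact norm_comm_orderTwo_orderOne_le (Ls j) dWaveFormFactor DWaveKT.pairNormConst_dWave_pos)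
    (by have := DWaveKT.pairNormConst_dWave_pos; positivity) hβ
    (by
      have hc : (fun j => Fintype.card (TorusSite 2 (Ls j))) = fun j => Ls j ^ 2 :=
        funext fun j => card_torusSite_two_dkms (Ls j)
      rw [hc]
      exact (tendsto_pow_atTop two_ne_zero).comp hLs)
    (c := Real.log 4) (fun j => log_card_fock_le (Ls j)) hσ
    (by
      filter_upwards [hLs.eventually hLRO] with j hj
      rw [dWaveZ2SystemTT'_moment_dWave, mul_one]
      exact hj)
    hB (half_pos hε)
  filter_upwards [h] with j hj
  rw [dWaveZ2SystemTT'_magnetisation_dWave] at hj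
  -- `Re⟨Δ + Δᴴ⟩ = 2 Re⟨Δ⟩` and the Gibbs state is the eigen-mixture
  have hmix : ∑ i, (sourcedGibbsWeightTT' β tp U μ B (Ls j) i : ℂ) *
      expect (pairField dWaveFormFactor (Ls j)) (sourcedGibbsVectorTT' tp U μ B (Ls j) i) =
        gibbsState β (dWaveSourceTorusTT' (Ls j) tp U μ B) (pairField dWaveFormFactor (Ls j)) :=
    (sum_sourcedGibbsWeightTT'_mul_expect_eq_gibbsState (Ls j) β tp U μ B _).trans (gibbsState_congr_inst _ _ _ _ _ _ _)
  have hre : (gibbsState β (dWaveSourceTorusTT' (Ls j) tp U μ B)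
      (pairField dWaveFormFactor (Ls j) + (pairField dWaveFormFactor (Ls j))ᴴ)).re =
        2 * ∑ i, sourcedGibbsWeightTT' β tp U μ B (Ls j) i *
          (expect (pairField dWaveFormFactor (Ls j)) (sourcedGibbsVectorTT' tp U μ B (Ls j) i)).re := by
    have hsum : (∑ i, sourcedGibbsWeightTT' β tp U μ B (Ls j) i *
        (expect (pairField dWaveFormFactor (Ls j)) (sourcedGibbsVectorTT' tp U μ B (Ls j) i)).re) =
          (gibbsState β (dWaveSourceTorusTT' (Ls j) tp U μ B) (pairField dWaveFormFactor (Ls j))).re := by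
      rw [← hmix, Complex.re_sum]
      exact Finset.sum_congr rfl fun i _ => by rw [Complex.re_ofReal_mul]
    rw [hsum, map_add, gibbsState_conjTranspose β (dWaveSourceTorusTT'_isHermitian (Ls j) tp U μ B), Complex.add_re,
      Complex.star_def, Complex.conj_re]
    ring
  rw [hre] at hj
  linarith

/-! ### §3 The pair amplitude of sourced / infinitesimal pair-field thermal states; `U(1)` breaking at `T > 0`

(Still inside the section with the Koma–Tasaki `DecidableEq (FermionTorus 2 L)` instance: the LRO hypotheses below are
finite-volume Gibbs expectations and must be stated in the same instance environment as the dictionary lemmas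
`dWaveZ2SystemTT'_moment_dWave` / `…_magnetisation_dWave`; consumers state them under
`attribute [local instance 10000] instDecidableEqFermionTorusKT` as every file of the Koma–Tasaki dictionary does.) -/

namespace InfVolFermionState

variable (tp U μ : ℝ) {β : ℝ}

/-- **THERMAL `d`-WAVE PAIR LRO FORCES THE PAIR AMPLITUDE OF EVERY SOURCED THERMAL STATE** (infinite volume, every site):
let `β > 0`, `B > 0`, and let `ω` be a torus limit of the Gibbs states of the pair-sourced tori `A_L(B)` along `Ls → ∞`. If
eventually in `L` the ZERO-source Gibbs states have `σ² ≤ (L²)⁻² Re⟨(Δ_d+Δ_d†)²⟩_{β, A_L(0)}` (`σ ≥ 0`), then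
`√2 σ ≤ 2 Re ω(P^d_x)` for every `x ∈ ℤ²`, `P^d_x = localPairAt {0,±e₁,±e₂} d x` — Koma–Tasaki's `m_Λ(B) → Re ω(P^d_x + P^d_x†)`
along the torus limit, and `liminf_Λ m_Λ(B) ≥ √2 σ` for every `B > 0` (KT93 Thm 2.1 / Cor 2.2-`U(1)` without hypothesis i)).
[cite: KomaTasaki1993, Theorem 2.1 (2.13), (2.11), Remark after Theorem 6.1] [cite: KomaTasaki1994, §3.4]
[cite: BratteliRobinsonI1987, §4.3.1] -/
theorem IsTorusLimitOfMixture.sqrt_two_mul_le_two_mul_re_expect_localPairAt_of_sourcedGibbs (hβ : 0 < β) {B : ℝ}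
    (hB : 0 < B) {ω : InfVolFermionState 2} {Ls : ℕ → ℕ}
    (hω : ω.IsTorusLimitOfMixture sourcedGibbsCount (sourcedGibbsWeightTT' β tp U μ B)
      (sourcedGibbsVectorTT' tp U μ B) Ls)
    (hLs : Tendsto Ls atTop atTop) {σ : ℝ} (hσ : 0 ≤ σ)
    (hLRO : ∀ᶠ L : ℕ in atTop, ∀ [NeZero L], σ ^ 2 ≤ (((L : ℝ) ^ 2) ^ 2)⁻¹ *
      (gibbsState β (dWaveSourceTorusTT' L tp U μ 0)
        ((pairField dWaveFormFactor L + (pairField dWaveFormFactor L)ᴴ) ^ 2)).re)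
    (x : Site 2) :
    Real.sqrt 2 * σ ≤ 2 * (ω.expect (pairRegion (insert (0 : Site 2) unitSteps) x)
      (localPairAt (insert (0 : Site 2) unitSteps) dWaveFormFactor x)).re := by
  rw [hω.isTranslationInvariant.expect_localPairAt_eq]
  -- pass to the tail `j ≥ j₀` where all sides are `≥ 3`
  obtain ⟨j₀, hj₀⟩ := eventually_atTop.1 (hLs.eventually_ge_atTop 3)
  have hLs' : Tendsto (Ls ∘ fun j => j + j₀) atTop atTop := hLs.comp (tendsto_add_atTop_nat j₀)
  haveI hL0 : ∀ j, NeZero ((Ls ∘ fun j => j + j₀) j) := fun j =>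
    ⟨by have := hj₀ (j + j₀) (Nat.le_add_left _ _); simp only [Function.comp_apply]; omega⟩
  have hω' := hω.comp_tendsto (tendsto_add_atTop_nat j₀)
  set Λ₀ := pairRegion (insert (0 : Site 2) unitSteps) 0 with hΛ₀
  set P₀ := localPairAt (insert (0 : Site 2) unitSteps) dWaveFormFactor 0 with hP₀
  -- the averaged pair field converges to `ω(P₀)`
  have hconv : Tendsto (fun j => 2 * (((((Ls ∘ fun j => j + j₀) j : ℕ) : ℝ) ^ 2)⁻¹ *
      ∑ i, sourcedGibbsWeightTT' β tp U μ B ((Ls ∘ fun j => j + j₀) j) i *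
        (QuantumLattice.expect (pairField dWaveFormFactor ((Ls ∘ fun j => j + j₀) j))
          (sourcedGibbsVectorTT' tp U μ B ((Ls ∘ fun j => j + j₀) j) i)).re)) atTop
      (𝓝 (2 * (ω.expect Λ₀ P₀).re)) := by
    refine (((Complex.continuous_re.tendsto _).comp (hω' Λ₀ P₀)).congr fun j => ?_).const_mul 2
    have h3 : 3 ≤ (Ls ∘ fun j => j + j₀) j := hj₀ (j + j₀) (Nat.le_add_left _ _)
    have hcast : ((((Ls ∘ fun j => j + j₀) j : ℕ) : ℂ) ^ 2) = (((((Ls ∘ fun j => j + j₀) j : ℕ) : ℝ) ^ 2 : ℝ) : ℂ) := by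
      push_cast; rfl
    rw [Function.comp_apply, sum_sourcedGibbsWeightTT'_mul_torusAvgExpect_localPairAt_zero _ β tp U μ B h3, hcast,
      Complex.div_ofReal_re, div_eq_inv_mul, Complex.re_sum]
    refine congrArg _ (Finset.sum_congr rfl fun i _ => ?_)
    rw [Complex.re_ofReal_mul]
  -- KT: eventually `√2 σ ≤ m_j + ε`
  refine le_of_forall_pos_le_add fun ε hε => ?_
  have hev := eventually_sqrt_two_mul_le_sourcedGibbsMixture_pairField tp U μ hβ hLs' hσ hLRO hB hε
  exact ge_of_tendsto (hconv.add_const ε) hev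

/-- **… AND OF EVERY ZERO-SOURCE LIMIT OF SOURCED THERMAL STATES** (KT93's `m_s ≥ √2σ` for electrons, in infinite volume):
if `ω_k` are torus limits of the Gibbs states of `A_L(h_k)` at `β > 0` with `h_k > 0`, converging to `ω` on every local
algebra, and the zero-source Gibbs states have thermal `d`-wave pair LRO `σ²` eventually in `L`, then
`√2 σ ≤ 2 Re ω(P^d_x)` at every site. [cite: KomaTasaki1993, §1 (1.8)–(1.10), Theorem 2.1] [cite: KomaTasaki1994, §3.4] -/
theorem sqrt_two_mul_le_two_mul_re_expect_localPairAt_of_tendsto_sourcedGibbs (hβ : 0 < β)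
    {ωk : ℕ → InfVolFermionState 2} {hk : ℕ → ℝ} {Lk : ℕ → ℕ → ℕ} {ω : InfVolFermionState 2}
    (hpos : ∀ k, 0 < hk k)
    (hωk : ∀ k, (ωk k).IsTorusLimitOfMixture sourcedGibbsCount (sourcedGibbsWeightTT' β tp U μ (hk k))
      (sourcedGibbsVectorTT' tp U μ (hk k)) (Lk k))
    (hLk : ∀ k, Tendsto (Lk k) atTop atTop)
    (hlim : ∀ (Λ : Finset (Site 2)) (A : FermionOp Λ), Tendsto (fun k => (ωk k).expect Λ A) atTop (𝓝 (ω.expect Λ A)))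
    {σ : ℝ} (hσ : 0 ≤ σ)
    (hLRO : ∀ᶠ L : ℕ in atTop, ∀ [NeZero L], σ ^ 2 ≤ (((L : ℝ) ^ 2) ^ 2)⁻¹ *
      (gibbsState β (dWaveSourceTorusTT' L tp U μ 0)
        ((pairField dWaveFormFactor L + (pairField dWaveFormFactor L)ᴴ) ^ 2)).re)
    (x : Site 2) :
    Real.sqrt 2 * σ ≤ 2 * (ω.expect (pairRegion (insert (0 : Site 2) unitSteps) x)
      (localPairAt (insert (0 : Site 2) unitSteps) dWaveFormFactor x)).re :=
  ge_of_tendsto (((Complex.continuous_re.tendsto _).comp (hlim _ _)).const_mul 2)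
    (Eventually.of_forall fun k =>
      (hωk k).sqrt_two_mul_le_two_mul_re_expect_localPairAt_of_sourcedGibbs tp U μ hβ (hpos k) (hLk k) hσ hLRO x)

/-- **`U(1)` BREAKING AT `T > 0` FROM THERMAL PAIR LONG-RANGE ORDER (Koma–Tasaki 1993 §1 for lattice electrons, 1994 §3.4).**
Let `β > 0` and suppose the zero-source grand-canonical Gibbs states of the `t–t'` Hubbard tori (`t = 1`) have thermal
`d`-wave pair long-range order, `σ² ≤ (L²)⁻² Re⟨(Δ_d+Δ_d†)²⟩_{β,L}` eventually in `L` with `σ > 0`. Let `ω` be any zero-source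
limit of sourced thermal states (`ω_k →` `ω` on every local algebra, `ω_k` a torus limit of the Gibbs states of `A_L(h_k)`,
`h_k ↓ 0`). Then: (i) `ω` is an equilibrium (dKMS) state at `β` of the grand-canonical `t–t'` Hubbard interaction
`gcInteractionTT' 1 t' U μ 0`; (ii) `Re ω(P^d_x) ≥ σ/√2 > 0` at every site, so `ω` is NOT gauge invariant and NOT a
thermodynamic limit of periodic-b.c. grand-canonical Gibbs states; (iii) the gauge orbit `{ω ∘ γ_θ}` consists of dKMS states at
`β` with pair amplitudes `e^{−2iθ} ω(P^d_x)`, pairwise distinct for `θ ∈ [0, π)` — a continuum of coexisting equilibrium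
states beside the gauge-symmetric PBC state: the `U(1)` symmetry is broken at inverse temperature `β`.  IMPLICATION ONLY: no
pair LRO is asserted for the Hubbard model. [cite: KomaTasaki1993, §1 (1.8)–(1.10), Theorem 2.1; §7 p. 211]
[cite: KomaTasaki1994, §3.4, Cor. 2.9] [cite: BratteliRobinsonII1997, Prop. 5.3.33, Thm. 5.3.30] [cite: ArakiMoriya2003, Def 6.3] -/
theorem hubbardTTPrime_U1Breaking_of_thermal_pairLRO_of_tendsto_sourcedGibbs (hβ : 0 < β)
    {ωk : ℕ → InfVolFermionState 2} {hk : ℕ → ℝ} {Lk : ℕ → ℕ → ℕ} {ω : InfVolFermionState 2}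
    (hpos : ∀ k, 0 < hk k) (hh : Tendsto hk atTop (𝓝 0))
    (hωk : ∀ k, (ωk k).IsTorusLimitOfMixture sourcedGibbsCount (sourcedGibbsWeightTT' β tp U μ (hk k))
      (sourcedGibbsVectorTT' tp U μ (hk k)) (Lk k))
    (hLk : ∀ k, Tendsto (Lk k) atTop atTop)
    (hlim : ∀ (Λ : Finset (Site 2)) (A : FermionOp Λ), Tendsto (fun k => (ωk k).expect Λ A) atTop (𝓝 (ω.expect Λ A)))
    {σ : ℝ} (hσ : 0 < σ)
    (hLRO : ∀ᶠ L : ℕ in atTop, ∀ [NeZero L], σ ^ 2 ≤ (((L : ℝ) ^ 2) ^ 2)⁻¹ *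
      (gibbsState β (dWaveSourceTorusTT' L tp U μ 0)
        ((pairField dWaveFormFactor L + (pairField dWaveFormFactor L)ᴴ) ^ 2)).re) :
    ω.IsDKMSState (gcInteractionTT' 1 tp U μ 0) 1 β ∧ ω.IsTranslationInvariant ∧
      (∀ x : Site 2, σ / Real.sqrt 2 ≤ (ω.expect (pairRegion (insert (0 : Site 2) unitSteps) x)
        (localPairAt (insert (0 : Site 2) unitSteps) dWaveFormFactor x)).re) ∧
      ¬ ω.IsGaugeInvariant ∧
      (∀ (β' : ℝ) (Ls : ℕ → ℕ), Tendsto Ls atTop atTop →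
        ¬ ω.IsTorusLimitOfMixture sourcedGibbsCount (gcGibbsWeightTT' β' 1 tp U μ 0) (gcGibbsVectorTT' 1 tp U μ 0) Ls) ∧
      (∀ θ : ℝ, (ω.gaugeShift θ).IsDKMSState (gcInteractionTT' 1 tp U μ 0) 1 β ∧
        ∀ x : Site 2, (ω.gaugeShift θ).expect (pairRegion (insert (0 : Site 2) unitSteps) x)
            (localPairAt (insert (0 : Site 2) unitSteps) dWaveFormFactor x) =
          Complex.exp (-(2 * (Complex.I * θ))) * ω.expect (pairRegion (insert (0 : Site 2) unitSteps) x)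
            (localPairAt (insert (0 : Site 2) unitSteps) dWaveFormFactor x)) ∧
      Set.InjOn (fun θ : ℝ => ω.gaugeShift θ) (Set.Ico 0 Real.pi) ∧
      ¬ (fermionDKMSStates (gcInteractionTT' 1 tp U μ 0) 1 β).Subsingleton := by
  have hdk : ω.IsDKMSState (gcInteractionTT' 1 tp U μ 0) 1 β :=
    IsDKMSState.gcInteractionTT'_of_tendsto_source
      (fun k => (hωk k).isDKMSState_of_sourcedGibbs tp U μ (hk k) (hLk k)) hh tendsto_const_nhds hlim
  have hfloor : ∀ x : Site 2, σ / Real.sqrt 2 ≤ (ω.expect (pairRegion (insert (0 : Site 2) unitSteps) x)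
      (localPairAt (insert (0 : Site 2) unitSteps) dWaveFormFactor x)).re := fun x => by
    have h := sqrt_two_mul_le_two_mul_re_expect_localPairAt_of_tendsto_sourcedGibbs tp U μ hβ hpos hωk hLk hlim hσ.le
      hLRO x
    have hs : (0 : ℝ) < Real.sqrt 2 := Real.sqrt_pos.2 (by norm_num)
    rw [div_le_iff₀ hs]
    have hss : Real.sqrt 2 * Real.sqrt 2 = 2 := Real.mul_self_sqrt (by norm_num)
    nlinarith
  have hne : ∀ x : Site 2, ω.expect (pairRegion (insert (0 : Site 2) unitSteps) x)
      (localPairAt (insert (0 : Site 2) unitSteps) dWaveFormFactor x) ≠ 0 := fun x h0 => by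
    have h := hfloor x
    rw [h0, Complex.zero_re] at h
    have : 0 < σ / Real.sqrt 2 := div_pos hσ (Real.sqrt_pos.2 (by norm_num))
    linarith
  have hTI : ω.IsTranslationInvariant :=
    isTranslationInvariant_of_tendsto_expect hlim fun k => (hωk k).isTranslationInvariant
  obtain ⟨horb, hinj⟩ := hdk.gaugeOrbit_gcTT' (hne 0)
  refine ⟨hdk, hTI, hfloor, ?_, fun β' Ls hLs => not_isTorusLimitOfMixture_gcGibbs_of_expect_localPairAt_ne_zero (hne 0) hLs,
    fun θ => ⟨(horb θ).1, fun x => ω.gaugeShift_expect_localPairAt θ _ dWaveFormFactor x⟩, hinj,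
    hdk.not_subsingleton_fermionDKMSStates_of_expect_localPairAt_ne_zero (hne 0)⟩
  intro hG
  exact hne 0 (hG.expect_eq_zero_of_hasGaugeCharge (by norm_num) (hasGaugeCharge_localPairAt _ dWaveFormFactor 0))

end InfVolFermionState

namespace DWaveKT

variable {β tp U μ : ℝ} {ω : InfVolFermionState 2}

/-- **THERMAL `d`-WAVE PAIR LRO FORCES THE PAIR AMPLITUDE OF EVERY SOURCED THERMAL STATE** (class form): for `β > 0`, `B > 0`,
a sourced thermal state `ω` at `(β, B)` and zero-source LRO `σ² ≤ (L²)⁻² Re⟨(Δ_d+Δ_d†)²⟩_{β, A_L(0)}` eventually in `L` (`σ ≥ 0`):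
`√2 σ ≤ 2 Re ω(P^d_x)` at every site — KT93 (2.13)/(2.18)-`U(1)`: `liminf_Λ m_Λ(B) ≥ √2σ`.
[cite: KomaTasaki1993, Theorem 2.1 (2.13), Remark after Theorem 6.1] [cite: KomaTasaki1994, §3.4] -/
theorem IsSourcedThermalState.sqrt_two_mul_le_two_mul_re_expect_localPairAt (hβ : 0 < β) {B : ℝ} (hB : 0 < B)
    (hω : IsSourcedThermalState β tp U μ B ω) {σ : ℝ} (hσ : 0 ≤ σ)
    (hLRO : ∀ᶠ L : ℕ in atTop, ∀ [NeZero L], σ ^ 2 ≤ (((L : ℝ) ^ 2) ^ 2)⁻¹ *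
      (gibbsState β (dWaveSourceTorusTT' L tp U μ 0)
        ((pairField dWaveFormFactor L + (pairField dWaveFormFactor L)ᴴ) ^ 2)).re)
    (x : Site 2) :
    Real.sqrt 2 * σ ≤ 2 * (ω.expect (pairRegion (insert (0 : Site 2) unitSteps) x)
      (localPairAt (insert (0 : Site 2) unitSteps) dWaveFormFactor x)).re := by
  obtain ⟨Ls, hLs, h⟩ := hω
  exact h.sqrt_two_mul_le_two_mul_re_expect_localPairAt_of_sourcedGibbs tp U μ hβ hB hLs hσ hLRO x

/-- **KT93 (1.10) FOR LATTICE ELECTRONS: `m_s ≥ √2 σ`** — thermal `d`-wave pair LRO of the zero-source Gibbs states forces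
`√2 σ ≤ 2 Re ω(P^d_x)` at every site in EVERY infinitesimal pair-field thermal state `ω` at `β > 0`.
[cite: KomaTasaki1993, §1 (1.8)–(1.10), Theorem 2.1; §7 p. 211] [cite: KomaTasaki1994, §3.4] -/
theorem IsInfinitesimalFieldThermalState.sqrt_two_mul_le_two_mul_re_expect_localPairAt (hβ : 0 < β)
    (hω : IsInfinitesimalFieldThermalState β tp U μ ω) {σ : ℝ} (hσ : 0 ≤ σ)
    (hLRO : ∀ᶠ L : ℕ in atTop, ∀ [NeZero L], σ ^ 2 ≤ (((L : ℝ) ^ 2) ^ 2)⁻¹ *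
      (gibbsState β (dWaveSourceTorusTT' L tp U μ 0)
        ((pairField dWaveFormFactor L + (pairField dWaveFormFactor L)ᴴ) ^ 2)).re)
    (x : Site 2) :
    Real.sqrt 2 * σ ≤ 2 * (ω.expect (pairRegion (insert (0 : Site 2) unitSteps) x)
      (localPairAt (insert (0 : Site 2) unitSteps) dWaveFormFactor x)).re := by
  obtain ⟨hk, ωk, hpos, -, hωk, hlim⟩ := hω
  exact ge_of_tendsto (((Complex.continuous_re.tendsto _).comp (hlim _ _)).const_mul 2)
    (Eventually.of_forall fun k => (hωk k).sqrt_two_mul_le_two_mul_re_expect_localPairAt hβ (hpos k) hσ hLRO x)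

/-- **`U(1)` BREAKING AT `T > 0` IN EVERY INFINITESIMAL PAIR-FIELD THERMAL STATE, FROM THERMAL PAIR LRO** (class form of
`InfVolFermionState.hubbardTTPrime_U1Breaking_of_thermal_pairLRO_of_tendsto_sourcedGibbs`): `β > 0`, zero-source thermal `d`-wave
pair LRO with `σ > 0` ⇒ an infinitesimal pair-field thermal state `ω` at `β` is a translation-invariant dKMS state of
`gcInteractionTT' 1 t' U μ 0` with `Re ω(P^d_x) ≥ σ/√2` at every site, not gauge invariant, not a PBC grand-canonical thermodynamic
limit, and `{ω ∘ γ_θ : θ ∈ [0,π)}` is an injective family of dKMS states at `β` (pair amplitudes `e^{−2iθ}ω(P^d_x)`); the set of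
equilibrium states at `β` is not a singleton. IMPLICATION ONLY. [cite: KomaTasaki1993, §1 (1.8)–(1.10); §7 p. 211]
[cite: KomaTasaki1994, §3.4, Cor. 2.9] [cite: BratteliRobinsonII1997, Prop. 5.3.33] [cite: ArakiMoriya2003, Def 6.3] -/
theorem IsInfinitesimalFieldThermalState.U1Breaking_of_thermal_pairLRO (hβ : 0 < β)
    (hω : IsInfinitesimalFieldThermalState β tp U μ ω) {σ : ℝ} (hσ : 0 < σ)
    (hLRO : ∀ᶠ L : ℕ in atTop, ∀ [NeZero L], σ ^ 2 ≤ (((L : ℝ) ^ 2) ^ 2)⁻¹ *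
      (gibbsState β (dWaveSourceTorusTT' L tp U μ 0)
        ((pairField dWaveFormFactor L + (pairField dWaveFormFactor L)ᴴ) ^ 2)).re) :
    ω.IsDKMSState (gcInteractionTT' 1 tp U μ 0) 1 β ∧ ω.IsTranslationInvariant ∧
      (∀ x : Site 2, σ / Real.sqrt 2 ≤ (ω.expect (pairRegion (insert (0 : Site 2) unitSteps) x)
        (localPairAt (insert (0 : Site 2) unitSteps) dWaveFormFactor x)).re) ∧
      ¬ ω.IsGaugeInvariant ∧
      (∀ (β' : ℝ) (Ls : ℕ → ℕ), Tendsto Ls atTop atTop →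
        ¬ ω.IsTorusLimitOfMixture sourcedGibbsCount (gcGibbsWeightTT' β' 1 tp U μ 0) (gcGibbsVectorTT' 1 tp U μ 0) Ls) ∧
      (∀ θ : ℝ, (ω.gaugeShift θ).IsDKMSState (gcInteractionTT' 1 tp U μ 0) 1 β ∧
        ∀ x : Site 2, (ω.gaugeShift θ).expect (pairRegion (insert (0 : Site 2) unitSteps) x)
            (localPairAt (insert (0 : Site 2) unitSteps) dWaveFormFactor x) =
          Complex.exp (-(2 * (Complex.I * θ))) * ω.expect (pairRegion (insert (0 : Site 2) unitSteps) x)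
            (localPairAt (insert (0 : Site 2) unitSteps) dWaveFormFactor x)) ∧
      Set.InjOn (fun θ : ℝ => ω.gaugeShift θ) (Set.Ico 0 Real.pi) ∧
      ¬ (fermionDKMSStates (gcInteractionTT' 1 tp U μ 0) 1 β).Subsingleton := by
  obtain ⟨hk, ωk, hpos, hh, hωk, hlim⟩ := hω
  choose Lk hLk hωk' using hωk
  exact InfVolFermionState.hubbardTTPrime_U1Breaking_of_thermal_pairLRO_of_tendsto_sourcedGibbs tp U μ hβ hpos hh hωk' hLk
    hlim hσ hLRO

/-- **THE EQUILIBRIUM STATES OF THE `t–t'` HUBBARD MODEL AT `β` UNDER THERMAL `d`-WAVE PAIR LRO** (existence form; `β > 0`,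
`σ > 0`, LRO eventually in `L` for the zero-source PBC Gibbs states): (a) the zero-source thermal state `ω₀` (a PBC grand-canonical
thermodynamic limit) is a gauge-INVARIANT dKMS state with `ω₀(P^d_x) = 0`; (b) an infinitesimal pair-field thermal state `ω` exists
and is a dKMS state with `Re ω(P^d_x) ≥ σ/√2 > 0`, not gauge invariant, with an injective circle `{ω ∘ γ_θ}` of dKMS states —
coexistence of the symmetric state and a continuum of symmetry-breaking equilibrium states at the same `β`: `U(1)` IS BROKEN.
Koma–Tasaki 1993 §1 ((1.5)–(1.10)) for the electron pair condensation problem (§7 p. 211; 1994 §3.4). IMPLICATION ONLY: no pair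
LRO is asserted for the Hubbard model at any `(t', U, μ, β)`. [cite: KomaTasaki1993, §1 (1.5)–(1.10), Theorem 2.1; §7 p. 211]
[cite: KomaTasaki1994, §3.4, Cor. 2.9] [cite: BratteliRobinsonII1997, Prop. 5.3.33, Thm. 5.3.30] [cite: ArakiMoriya2003, Def 6.3] -/
theorem hubbardTTPrime_thermal_pairLRO_U1Breaking (tp U μ : ℝ) {β : ℝ} (hβ : 0 < β) {σ : ℝ} (hσ : 0 < σ)
    (hLRO : ∀ᶠ L : ℕ in atTop, ∀ [NeZero L], σ ^ 2 ≤ (((L : ℝ) ^ 2) ^ 2)⁻¹ *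
      (gibbsState β (dWaveSourceTorusTT' L tp U μ 0)
        ((pairField dWaveFormFactor L + (pairField dWaveFormFactor L)ᴴ) ^ 2)).re) :
    (∃ ω₀ : InfVolFermionState 2, IsSourcedThermalState β tp U μ 0 ω₀ ∧ ω₀.IsDKMSState (gcInteractionTT' 1 tp U μ 0) 1 β ∧
        ω₀.IsGaugeInvariant ∧
        ∀ x : Site 2, ω₀.expect (pairRegion (insert (0 : Site 2) unitSteps) x)
          (localPairAt (insert (0 : Site 2) unitSteps) dWaveFormFactor x) = 0) ∧
    ∃ ω : InfVolFermionState 2, IsInfinitesimalFieldThermalState β tp U μ ω ∧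
      ω.IsDKMSState (gcInteractionTT' 1 tp U μ 0) 1 β ∧ ω.IsTranslationInvariant ∧
      (∀ x : Site 2, σ / Real.sqrt 2 ≤ (ω.expect (pairRegion (insert (0 : Site 2) unitSteps) x)
        (localPairAt (insert (0 : Site 2) unitSteps) dWaveFormFactor x)).re) ∧
      ¬ ω.IsGaugeInvariant ∧
      (∀ (β' : ℝ) (Ls : ℕ → ℕ), Tendsto Ls atTop atTop →
        ¬ ω.IsTorusLimitOfMixture sourcedGibbsCount (gcGibbsWeightTT' β' 1 tp U μ 0) (gcGibbsVectorTT' 1 tp U μ 0) Ls) ∧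
      (∀ θ : ℝ, (ω.gaugeShift θ).IsDKMSState (gcInteractionTT' 1 tp U μ 0) 1 β ∧
        ∀ x : Site 2, (ω.gaugeShift θ).expect (pairRegion (insert (0 : Site 2) unitSteps) x)
            (localPairAt (insert (0 : Site 2) unitSteps) dWaveFormFactor x) =
          Complex.exp (-(2 * (Complex.I * θ))) * ω.expect (pairRegion (insert (0 : Site 2) unitSteps) x)
            (localPairAt (insert (0 : Site 2) unitSteps) dWaveFormFactor x)) ∧
      Set.InjOn (fun θ : ℝ => ω.gaugeShift θ) (Set.Ico 0 Real.pi) ∧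
      ¬ (fermionDKMSStates (gcInteractionTT' 1 tp U μ 0) 1 β).Subsingleton := by
  refine ⟨?_, ?_⟩
  · obtain ⟨ω₀, hω₀⟩ := exists_isSourcedThermalState β tp U μ 0
    exact ⟨ω₀, hω₀, hω₀.isDKMSState_gcInteractionTT'_of_zero, hω₀.isGaugeInvariant_of_zero, fun x =>
      hω₀.expect_localPairAt_eq_zero_of_zero _ _ x⟩
  · obtain ⟨ω, hω⟩ := exists_isInfinitesimalFieldThermalState β tp U μ
    exact ⟨ω, hω, hω.U1Breaking_of_thermal_pairLRO hβ hσ hLRO⟩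

/-! ### §4 Zero-temperature limits of Koma–Tasaki's thermal states are ground states of the `t–t'` Hubbard model -/

/-- **`β_k → ∞`, `h_k → h` limits of sourced thermal states are infinite-volume GROUND states of the sourced interaction at `h`**
(Bratteli–Kishimoto–Robinson along the source pencil, `DWaveSourceThermalStatesDKMS` §5). [cite: BratteliKishimotoRobinson1978, §I (p. 41)]
[cite: KomaTasaki1993, §1 (ground states as `β ↑ ∞` after `Λ ↑ ∞`)] -/
theorem isGroundState_of_sourcedThermalStates_tendsto_atTop {tp U μ : ℝ} {ωk : ℕ → InfVolFermionState 2} {βk hk : ℕ → ℝ} {h : ℝ}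
    {ω : InfVolFermionState 2} (hωk : ∀ k, IsSourcedThermalState (βk k) tp U μ (hk k) (ωk k))
    (hβ : Tendsto βk atTop atTop) (hh : Tendsto hk atTop (𝓝 h))
    (hlim : ∀ (Λ : Finset (Site 2)) (A : FermionOp Λ), Tendsto (fun k => (ωk k).expect Λ A) atTop (𝓝 (ω.expect Λ A))) :
    ω.IsGroundState (hubbardTTPrimeSourcedInteraction 1 tp U μ dWaveFormFactor h) 1 :=
  InfVolFermionState.IsGroundState.hubbardTTPrimeSourced_of_isDKMSState_tendsto_atTop (fun k => (hωk k).isDKMSState) hh hβ hlim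

/-- **`β_k → ∞`, `h_k → 0` limits of sourced thermal states are infinite-volume ground states of the `t–t'` Hubbard model**
(`gcInteractionTT' 1 t' U μ 0`) — Koma–Tasaki's ground states «`β ↑ ∞` after `Λ ↑ ∞`», along any joint schedule of source and
temperature. [cite: KomaTasaki1993, §1] [cite: BratteliKishimotoRobinson1978, §I (p. 41)] [cite: KomaTasaki1994, §1 (1.8)] -/
theorem isGroundState_gcInteractionTT'_of_sourcedThermalStates_tendsto_atTop {tp U μ : ℝ} {ωk : ℕ → InfVolFermionState 2}
    {βk hk : ℕ → ℝ} {ω : InfVolFermionState 2} (hωk : ∀ k, IsSourcedThermalState (βk k) tp U μ (hk k) (ωk k))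
    (hβ : Tendsto βk atTop atTop) (hh : Tendsto hk atTop (𝓝 0))
    (hlim : ∀ (Λ : Finset (Site 2)) (A : FermionOp Λ), Tendsto (fun k => (ωk k).expect Λ A) atTop (𝓝 (ω.expect Λ A))) :
    ω.IsGroundState (gcInteractionTT' 1 tp U μ 0) 1 :=
  InfVolFermionState.IsGroundState.gcInteractionTT'_of_isDKMSState_tendsto_source_atTop (fun k => (hωk k).isDKMSState) hh hβ hlim

/-- **Zero-temperature limits of infinitesimal pair-field thermal states are ground states of the `t–t'` Hubbard model**
(`β_k → ∞`; Bratteli–Kishimoto–Robinson). [cite: BratteliKishimotoRobinson1978, §I (p. 41)] [cite: KomaTasaki1993, §1] -/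
theorem isGroundState_of_infinitesimalFieldThermalStates_tendsto_atTop {tp U μ : ℝ} {ωk : ℕ → InfVolFermionState 2} {βk : ℕ → ℝ}
    {ω : InfVolFermionState 2} (hωk : ∀ k, IsInfinitesimalFieldThermalState (βk k) tp U μ (ωk k))
    (hβ : Tendsto βk atTop atTop)
    (hlim : ∀ (Λ : Finset (Site 2)) (A : FermionOp Λ), Tendsto (fun k => (ωk k).expect Λ A) atTop (𝓝 (ω.expect Λ A))) :
    ω.IsGroundState (gcInteractionTT' 1 tp U μ 0) 1 :=
  InfVolFermionState.IsGroundState.of_isDKMSState_tendsto_atTop (fun k => (hωk k).isDKMSState) hβ hlim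

/-- **Such zero-temperature limits exist** (choose an infinitesimal pair-field thermal state at each `β_k`, extract a weak-⋆ convergent
subsequence), for every `β_k → ∞`. [cite: BratteliRobinsonI1987, Thm. 2.3.15] [cite: BratteliKishimotoRobinson1978, §I (p. 41)] -/
theorem exists_isGroundState_of_infinitesimalFieldThermalStates (tp U μ : ℝ) {βk : ℕ → ℝ} (hβ : Tendsto βk atTop atTop) :
    ∃ (ωk : ℕ → InfVolFermionState 2) (φ : ℕ → ℕ) (ω : InfVolFermionState 2), StrictMono φ ∧
      (∀ k, IsInfinitesimalFieldThermalState (βk k) tp U μ (ωk k)) ∧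
      (∀ (Λ : Finset (Site 2)) (A : FermionOp Λ), Tendsto (fun k => (ωk (φ k)).expect Λ A) atTop (𝓝 (ω.expect Λ A))) ∧
      ω.IsGroundState (gcInteractionTT' 1 tp U μ 0) 1 ∧ ω.IsTranslationInvariant := by
  choose ωk hωk using fun k => exists_isInfinitesimalFieldThermalState (βk k) tp U μ
  obtain ⟨φ, hφ, ω, hlim⟩ := InfVolFermionState.exists_tendsto_expect_subseq ωk
  exact ⟨ωk, φ, ω, hφ, hωk, hlim,
    isGroundState_of_infinitesimalFieldThermalStates_tendsto_atTop (fun k => hωk (φ k)) (hβ.comp hφ.tendsto_atTop) hlim,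
    InfVolFermionState.isTranslationInvariant_of_tendsto_expect hlim fun k => (hωk (φ k)).isTranslationInvariant⟩

end DWaveKT

end KTFloor

/-! ### §5 Mermin–Wagner for Koma–Tasaki's thermal states: Bogoliubov rows, no pair amplitude, gauge invariance — and NO thermal
`d`-wave pair long-range order in the two-dimensional `t–t'` Hubbard model, for every `t'` -/

namespace InfVolFermionState

/-- **Thermal states of the pair-sourced torus have the Bogoliubov rows of the SOURCED interaction** `Φ(1,t',U) − μn − hP_d`
(range `1`) at every `β ≥ 0` (`DWaveSourceThermalStatesBogoliubovRows`, packaged in the predicate of `FermionBogoliubovRowsMerminWagner`).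
[cite: DLS1978, §2 eq. (28)] [cite: KomaTasaki1993, §1 (1.8)] -/
theorem IsTorusLimitOfMixture.hasBogoliubovRows_of_sourcedGibbs {β : ℝ} (hβ : 0 ≤ β) (tp U μ h : ℝ) {ω : InfVolFermionState 2}
    {Ls : ℕ → ℕ}
    (hω : ω.IsTorusLimitOfMixture sourcedGibbsCount (sourcedGibbsWeightTT' β tp U μ h) (sourcedGibbsVectorTT' tp U μ h) Ls)
    (hLs : Tendsto Ls atTop atTop) :
    ω.HasBogoliubovRows (hubbardTTPrimeSourcedInteraction 1 tp U μ dWaveFormFactor h) 1 β :=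
  fun _ _ hΛ h8 A C => hω.bogoliubovRow_nonneg_of_sourcedGibbs hβ tp U μ h hLs hΛ h8 A C

/-- **Limits of states with the Bogoliubov rows of the pair-sourced `t–t'` interaction along `h_k → h`, `β_k → β` have the rows at
`(h, β)`** (the sourced interaction is the pencil `(Φ(t,t',U) − μn) + (−h)·P_g`; `HasBogoliubovRows.of_tendsto_pencil`).
[cite: BratteliRobinsonII1997, Prop. 5.3.25] [cite: DLS1978, §2 eq. (28)] -/
theorem HasBogoliubovRows.hubbardTTPrimeSourced_of_tendsto {t t' U μ : ℝ} {g : Site 2 → ℝ} {R : ℝ}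
    {ωk : ℕ → InfVolFermionState 2} {hk βk : ℕ → ℝ} {h β : ℝ} {ω : InfVolFermionState 2}
    (hrk : ∀ k, (ωk k).HasBogoliubovRows (hubbardTTPrimeSourcedInteraction t t' U μ g (hk k)) R (βk k))
    (hh : Tendsto hk atTop (𝓝 h)) (hβ : Tendsto βk atTop (𝓝 β))
    (hlim : ∀ (Λ : Finset (Site 2)) (A : FermionOp Λ), Tendsto (fun k => (ωk k).expect Λ A) atTop (𝓝 (ω.expect Λ A))) :
    ω.HasBogoliubovRows (hubbardTTPrimeSourcedInteraction t t' U μ g h) R β :=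
  HasBogoliubovRows.of_tendsto_pencil (Ψ₀ := hubbardTTPrimeMuInteraction t t' U μ) (Ψ₁ := pairSourceInteraction g)
    (sk := fun k => -hk k) hrk hh.neg hβ hlim

/-- **ZERO-SOURCE LIMITS OF STATES WITH THE BOGOLIUBOV ROWS OF THE PAIR-SOURCED MODEL HAVE THE BOGOLIUBOV ROWS OF THE `t–t'` HUBBARD
MODEL** `gcInteractionTT' t t' U μ 0` (`h_k → 0`, `β_k → β`): Koma–Tasaki's infinitesimal-field states inherit Bogoliubov's inequality
for the UNPERTURBED dynamics. [cite: KomaTasaki1993, §1 (1.8)] [cite: BratteliRobinsonII1997, Prop. 5.3.25] [cite: DLS1978, §2 eq. (28)] -/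
theorem HasBogoliubovRows.gcInteractionTT'_of_tendsto_source {t t' U μ : ℝ} {g : Site 2 → ℝ} {R : ℝ}
    {ωk : ℕ → InfVolFermionState 2} {hk βk : ℕ → ℝ} {β : ℝ} {ω : InfVolFermionState 2}
    (hrk : ∀ k, (ωk k).HasBogoliubovRows (hubbardTTPrimeSourcedInteraction t t' U μ g (hk k)) R (βk k))
    (hh : Tendsto hk atTop (𝓝 0)) (hβ : Tendsto βk atTop (𝓝 β))
    (hlim : ∀ (Λ : Finset (Site 2)) (A : FermionOp Λ), Tendsto (fun k => (ωk k).expect Λ A) atTop (𝓝 (ω.expect Λ A))) :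
    ω.HasBogoliubovRows (gcInteractionTT' t t' U μ 0) R β := by
  rw [← hubbardTTPrimeSourcedInteraction_zero_eq_gcInteractionTT' t t' U μ g]
  exact HasBogoliubovRows.hubbardTTPrimeSourced_of_tendsto hrk hh hβ hlim

end InfVolFermionState

namespace DWaveKT

variable {β tp U μ h : ℝ} {ω : InfVolFermionState 2}

/-- **Sourced thermal states have the Bogoliubov rows of the sourced interaction** at `β ≥ 0`. [cite: DLS1978, §2 eq. (28)]
[cite: KomaTasaki1993, §1 (1.8)] -/
theorem IsSourcedThermalState.hasBogoliubovRows (hβ : 0 ≤ β) (hω : IsSourcedThermalState β tp U μ h ω) :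
    ω.HasBogoliubovRows (hubbardTTPrimeSourcedInteraction 1 tp U μ dWaveFormFactor h) 1 β := by
  obtain ⟨Ls, hLs, h⟩ := hω
  exact h.hasBogoliubovRows_of_sourcedGibbs hβ tp U μ _ hLs

/-- **INFINITESIMAL PAIR-FIELD THERMAL STATES HAVE THE BOGOLIUBOV ROWS OF THE `t–t'` HUBBARD MODEL** `gcInteractionTT' 1 t' U μ 0`
at `β ≥ 0` (the rows are affine in the source `h` and survive `h_k ↓ 0`). [cite: KomaTasaki1993, §1 (1.8)] [cite: DLS1978, §2 eq. (28)]
[cite: BratteliRobinsonII1997, Prop. 5.3.25] -/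
theorem IsInfinitesimalFieldThermalState.hasBogoliubovRows (hβ : 0 ≤ β) (hω : IsInfinitesimalFieldThermalState β tp U μ ω) :
    ω.HasBogoliubovRows (gcInteractionTT' 1 tp U μ 0) 1 β := by
  obtain ⟨hk, ωk, -, hh, hωk, hlim⟩ := hω
  exact InfVolFermionState.HasBogoliubovRows.gcInteractionTT'_of_tendsto_source (fun k => (hωk k).hasBogoliubovRows hβ) hh
    tendsto_const_nhds hlim

/-- **MERMIN–WAGNER FOR KOMA–TASAKI'S INFINITESIMAL PAIR-FIELD THERMAL STATES (Klein–Landau–Shucker)**: at every `β ≥ 0`, every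
infinitesimal pair-field thermal state of the 2D `t–t'` Hubbard model annihilates every local observable of nonzero particle number
(`N_Λ O − O N_Λ = κO`, `κ ≠ 0`). [cite: KleinLandauShucker1981] [cite: KomaTasakiPRL1992, p. 3] [cite: ArakiMoriya2003, Theorem 12.11] -/
theorem IsInfinitesimalFieldThermalState.expect_eq_zero_of_numberCharged (hβ : 0 ≤ β) (hω : IsInfinitesimalFieldThermalState β tp U μ ω)
    {Λ : Finset (Site 2)} (O : FermionOp Λ) {κ : ℂ} (hκ : κ ≠ 0)
    (hO : (totalNumber : FermionOp Λ) * O - O * totalNumber = κ • O) : ω.expect Λ O = 0 :=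
  (hω.hasBogoliubovRows hβ).expect_eq_zero_of_numberCharged_ttPrime 1 tp U μ 0 hβ O hκ hO

/-- **… in particular `ω(P_x) = 0` for every local singlet pair** (any stencil `S`, form factor `g`, site `x`; e.g. the `d`-wave pair):
Koma–Tasaki's symmetry-breaking construction produces NO pair amplitude in two dimensions at `T > 0` (nor at `β = 0`).
[cite: KleinLandauShucker1981] [cite: KomaTasakiPRL1992, p. 3] -/
theorem IsInfinitesimalFieldThermalState.expect_localPairAt_eq_zero (hβ : 0 ≤ β) (hω : IsInfinitesimalFieldThermalState β tp U μ ω)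
    (S : Finset (Site 2)) (g : Site 2 → ℝ) (x : Site 2) : ω.expect (pairRegion S x) (localPairAt S g x) = 0 :=
  (hω.hasBogoliubovRows hβ).expect_localPairAt_eq_zero_ttPrime 1 tp U μ 0 hβ S g x

/-- **EVERY INFINITESIMAL PAIR-FIELD THERMAL STATE OF THE 2D `t–t'` HUBBARD MODEL IS GAUGE INVARIANT** (`β ≥ 0`): the `U(1)` symmetry
is NOT broken at `T > 0` by Koma–Tasaki's construction in two dimensions — the state obtained «by applying an infinitesimally small
symmetry breaking field» is `U(1)`-symmetric. [cite: KleinLandauShucker1981] [cite: BratteliRobinsonII1997, §5.2.2]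
[cite: KomaTasaki1993, §1 (1.8)] -/
theorem IsInfinitesimalFieldThermalState.isGaugeInvariant (hβ : 0 ≤ β) (hω : IsInfinitesimalFieldThermalState β tp U μ ω) :
    ω.IsGaugeInvariant :=
  (hω.hasBogoliubovRows hβ).isGaugeInvariant_ttPrime 1 tp U μ 0 hβ

/-- **Summary at `β ≥ 0`**: an infinitesimal pair-field thermal state of the 2D `t–t'` Hubbard model is a translation-invariant,
GAUGE-INVARIANT dKMS state of `gcInteractionTT' 1 t' U μ 0` with the Bogoliubov rows and zero pair amplitude on every local singlet pair.
[cite: KomaTasaki1993, §1 (1.8)] [cite: KleinLandauShucker1981] [cite: ArakiMoriya2003, Def 6.3, Theorem 12.11] -/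
theorem IsInfinitesimalFieldThermalState.symmetric_summary (hβ : 0 ≤ β) (hω : IsInfinitesimalFieldThermalState β tp U μ ω) :
    ω.IsDKMSState (gcInteractionTT' 1 tp U μ 0) 1 β ∧ ω.IsTranslationInvariant ∧ ω.IsGaugeInvariant ∧
      ω.HasBogoliubovRows (gcInteractionTT' 1 tp U μ 0) 1 β ∧
      ∀ (S : Finset (Site 2)) (g : Site 2 → ℝ) (x : Site 2), ω.expect (pairRegion S x) (localPairAt S g x) = 0 :=
  ⟨hω.isDKMSState, hω.isTranslationInvariant, hω.isGaugeInvariant hβ, hω.hasBogoliubovRows hβ,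
    hω.expect_localPairAt_eq_zero hβ⟩

end DWaveKT

section NoThermalPairLRO

attribute [local instance 10000] instDecidableEqFermionTorusKT

/-- **NO THERMAL `d`-WAVE PAIR LONG-RANGE ORDER IN THE TWO-DIMENSIONAL `t–t'` HUBBARD MODEL, FOR EVERY `t'`, `U`, `μ` AND EVERY
`β > 0`.** The hypothesis `hLRO` of §3 — `σ² ≤ (L²)⁻² Re⟨(Δ_d + Δ_d†)²⟩_{β, A_L(0)}` for all large `L`, with `σ > 0`, for the
zero-source periodic-b.c. grand-canonical Gibbs states of `H_L(1,t',U) − μN` — is FALSE: by §3(b) it would force `√2σ ≤ 2 Re ω(P^d_0)`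
in an infinitesimal pair-field thermal state `ω` at `β` (which exists, §1), while `ω(P^d_0) = 0` by the Mermin–Wagner theorem of §5.
Koma–Tasaki's `T > 0` symmetry-breaking mechanism is void for pairing in two dimensions, in accordance with Koma–Tasaki PRL 1992 /
Klein–Landau–Shucker; the implications §3(c),(d) hold vacuously. [cite: KleinLandauShucker1981] [cite: KomaTasakiPRL1992, p. 3]
[cite: KomaTasaki1993, §1 (1.8)–(1.10), Theorem 2.1] -/
theorem DWaveKT.not_thermal_dWavePairLRO (tp U μ : ℝ) {β : ℝ} (hβ : 0 < β) {σ : ℝ} (hσ : 0 < σ) :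
    ¬ (∀ᶠ L : ℕ in atTop, ∀ [NeZero L], σ ^ 2 ≤ (((L : ℝ) ^ 2) ^ 2)⁻¹ *
      (gibbsState β (dWaveSourceTorusTT' L tp U μ 0)
        ((pairField dWaveFormFactor L + (pairField dWaveFormFactor L)ᴴ) ^ 2)).re) := by
  intro hLRO
  obtain ⟨ω, hω⟩ := DWaveKT.exists_isInfinitesimalFieldThermalState β tp U μ
  have hfloor := hω.sqrt_two_mul_le_two_mul_re_expect_localPairAt hβ hσ.le hLRO 0
  rw [hω.expect_localPairAt_eq_zero hβ.le, Complex.zero_re, mul_zero] at hfloor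
  have h2 : 0 < Real.sqrt 2 * σ := by positivity
  linarith

/-- **Equivalently: the normalised pair-field fluctuation of the zero-source Gibbs states dips below every `ε > 0` for arbitrarily
large `L`** — `liminf_{L→∞} (L²)⁻² Re⟨(Δ_d + Δ_d†)²⟩_{β, H_L(1,t',U) − μN} = 0` for every `β > 0`, `t'`, `U`, `μ` (no number of record:
the quantitative decay is the McBryan–Spencer bound of `HubbardBondPairDecaySharpTTPrime`). [cite: KleinLandauShucker1981]
[cite: KomaTasakiPRL1992, p. 3] -/
theorem DWaveKT.frequently_thermal_dWavePairCorrelation_lt (tp U μ : ℝ) {β : ℝ} (hβ : 0 < β) {ε : ℝ} (hε : 0 < ε) :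
    ∃ᶠ L : ℕ in atTop, ∀ [NeZero L], (((L : ℝ) ^ 2) ^ 2)⁻¹ *
      (gibbsState β (dWaveSourceTorusTT' L tp U μ 0)
        ((pairField dWaveFormFactor L + (pairField dWaveFormFactor L)ᴴ) ^ 2)).re < ε := by
  have h := DWaveKT.not_thermal_dWavePairLRO tp U μ hβ (Real.sqrt_pos.2 hε)
  rw [Real.sq_sqrt hε.le, Filter.not_eventually] at h
  refine h.mono fun L hL => ?_
  intro inst
  exact lt_of_not_ge fun hge => hL (by intro inst'; exact hge)

end NoThermalPairLRO

end Literature.MathematicalPhysics.QuantumLattice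

end
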